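/-
Copyright (c) 2026. All rights reserved.
Released under Apache 2.0 license as described in the file LICENSE.
Authors: abc-iut cell, wave-2 discharge seat abc-iut-L6-t6 (proof-only companion of abc-iut-L6-t4's
`ThetaPilotObjects.lean`).
-/
import Mathlib.Tactic.Ring
import Literature.IUT.LogThetaLattice.ThetaPilotObjects

/-!
# [IUTchIII] Proposition 3.7 / Definition 3.8 (i): generators up to torsion and the well-definedness of the Θ-pilot object (proof-only companion)

Proof-only companion (DISCHARGE-L6 §E2, LIST C item C2) of
`Literature/IUT/LogThetaLattice/ThetaPilotObjects.lean` (seat abc-iut-L6-t4, p403954), which types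
S. Mochizuki, *Inter-universal Teichmüller Theory III*, kurims manuscript (May 2020), Proposition 3.7
pp. 109–112 and Definition 3.8 pp. 112–114 [claim key Mochizuki2012, status disputed, D-0012]
STATEMENTS-FIRST: Proposition 3.7 (i)–(v) as the OUTPUT SIGNATURE `GlobalLGPFrobenioidSignature`, the
Θ-pilot object of Definition 3.8 (i) as the value `thetaPilotObject` of the object-forming algorithm of
Proposition 3.7 (v) on a CHOSEN collection of generators up to torsion of the splitting monoids
`Ψ^⊥_{𝓕_lgp}(†𝓗𝓣)_v`, `v ∈ 𝕍^bad`, and the implicit well-definedness claim of Definition 3.8 (i) ("determined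
by ANY collection … of generators up to torsion") as the named statement `thetaPilotObject_wellDefined`.

Outcome of the discharge pass, per printed sub-item (DISCHARGE-L6 §E2 vocabulary):

* Prop. 3.7 (i)–(v) — NEEDS. A construction over other seats' REAL objects (`𝓕^⊩`-prime-strips and the
  strips `†𝔉^⊩_gau`, `*𝔉^⊩_△` of [IUTchII] Def. 4.9 / Cor. 4.10: abc-iut-L6-t2; Θ^{±ell}NF-Hodge theaters:
  abc-iut-L5-t4; Frobenioids and realifications [FrdI]: layer L1). The one piece of (i)/(ii) that is
  concrete today — the natural isomorphism `(†𝓕⊛_𝔪𝔬𝔡)_j ⥲ (†𝓕⊛_MOD)_j` between the local-fractional-ideal and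
  rational-function-torsor models of Example 3.6 — is kernel-checked at the level of objects and
  elementary morphisms in the sibling companion `GlobalFrobenioidModelsProofs.lean` (fully faithful +
  essentially surjective), to be instantiated at the number fields `(†𝕄⊛_MOD)_j` once they are real.
* Def. 3.8 (i), well-definedness of the Θ-pilot object — PROVED CONDITIONALLY, and the condition
  isolated: in a commutative monoid with cancellation (the splitting monoids at bad `v` are of the shape
  `μ_{2l} × q_v^ℕ` inside an integral domain, [IUTchII] Cor. 3.6), ANY TWO generators up to torsion differ
  by a torsion factor (`IsGeneratorUpToTorsion.exists_torsion_mul_eq`), so the Θ-pilot object is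
  independent of the choice of generators AS SOON AS the object-forming algorithm of Prop. 3.7 (v) is
  insensitive to torsion (= unit) factors of its inputs (`thetaPilotObject_wellDefined_of_torsionInvariant`)
  — which is the printed "local fractional ideals GENERATED BY elements of the monoids" (p. 112 l. 8: an
  ideal does not see unit factors of its generator). Unconditionally `thetaPilotObject_wellDefined` is a
  SLOT (the algorithm `objOfLgp` is abstract). Also recorded: torsion translates of a generator up to
  torsion are generators up to torsion (`IsGeneratorUpToTorsion.torsion_mul`), and the notion is not
  vacuous nor trivial (`isGeneratorUpToTorsion_one_iff`: `1` is a generator up to torsion iff the monoid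
  is torsion).

No new definitions. Nothing in this file bears on the disputed [IUTchIII] Cor. 3.12.
-/

namespace Literature.IUT.LogThetaLattice

universe u v w

/-! ## Generators up to torsion ([IUTchIII] Def. 3.8 (i), p. 112) in a commutative monoid -/

section Generators

variable {N : Type w} [CommMonoid N]

/-- A torsion translate `t · g` of a generator up to torsion `g` is again a generator up to torsion
(the collections of generators "indexed by `v ∈ 𝕍^bad`" of Def. 3.8 (i), p. 112, are torsors under the
torsion subgroups). [cite: Mochizuki2012, III Def 3.8 (i) p.112] -/
theorem IsGeneratorUpToTorsion.torsion_mul {g t : N} (hg : IsGeneratorUpToTorsion g) {k : ℕ}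
    (hk : 0 < k) (ht : t ^ k = 1) : IsGeneratorUpToTorsion (t * g) := by
  intro x
  obtain ⟨s, j, n, hj, hs, hx⟩ := hg x
  refine ⟨s * t ^ (n * (k - 1)), j * k, n, Nat.mul_pos hj hk, ?_, ?_⟩
  · rw [mul_pow, pow_mul, hs, one_pow, one_mul, ← pow_mul,
      show n * (k - 1) * (j * k) = k * (n * (k - 1) * j) by ring, pow_mul, ht, one_pow]
  · rw [hx, mul_pow, mul_assoc, ← mul_assoc (t ^ (n * (k - 1))), ← pow_add, mul_comm n (k - 1),
      ← Nat.succ_mul, Nat.succ_eq_add_one, Nat.sub_add_cancel hk, pow_mul, ht, one_pow, one_mul]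

/-- `1` is a generator up to torsion exactly when every element is torsion — so for the splitting
monoids `μ_{2l} × q_v^ℕ` of Def. 3.8 (i) (p. 112) the notion is neither vacuous nor trivial.
[cite: Mochizuki2012, III Def 3.8 (i) p.112] -/
theorem isGeneratorUpToTorsion_one_iff :
    IsGeneratorUpToTorsion (1 : N) ↔ ∀ x : N, ∃ k : ℕ, 0 < k ∧ x ^ k = 1 := by
  constructor
  · intro h x
    obtain ⟨t, k, n, hk, ht, hx⟩ := h x
    rw [one_pow, mul_one] at hx
    exact ⟨k, hk, by rw [hx, ht]⟩
  · intro h x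
    obtain ⟨k, hk, hx⟩ := h x
    exact ⟨x, k, 0, hk, hx, by rw [pow_zero, mul_one]⟩

variable [IsCancelMul N]

/-- **Any two generators up to torsion differ by a torsion factor** (commutative monoid with
cancellation): if `g` and `g'` are both generators up to torsion then `g' = t · g` with `t` torsion.
(Write `g' = t₁ g^n`, `g = t₂ g'^m`; then `g = (t₂t₁^m) g^{nm}`, so either `n = m = 1`, or `g` — hence
every element — is torsion, in which case `t := g' g^{E-1}` works for `g^E = 1`.) This is the
mathematical content of "determined by ANY collection … of generators up to torsion" in Def. 3.8 (i),
p. 112. [cite: Mochizuki2012, III Def 3.8 (i) p.112] -/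
theorem IsGeneratorUpToTorsion.exists_torsion_mul_eq {g g' : N} (hg : IsGeneratorUpToTorsion g)
    (hg' : IsGeneratorUpToTorsion g') : ∃ t : N, (∃ k : ℕ, 0 < k ∧ t ^ k = 1) ∧ g' = t * g := by
  obtain ⟨t₁, k₁, n, hk₁, ht₁, h₁⟩ := hg g'
  obtain ⟨t₂, k₂, m, hk₂, ht₂, h₂⟩ := hg' g
  -- if `g` is torsion, `t := g' · g^(E-1)` does it
  have key : ∀ E : ℕ, 0 < E → g ^ E = 1 →
      ∃ t : N, (∃ k : ℕ, 0 < k ∧ t ^ k = 1) ∧ g' = t * g := by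
    intro E hE hgE
    have hg'E : g' ^ (k₁ * E) = 1 := by
      rw [h₁, mul_pow, pow_mul, ht₁, one_pow, one_mul, ← pow_mul,
        show n * (k₁ * E) = E * (n * k₁) by ring, pow_mul, hgE, one_pow]
    refine ⟨g' * g ^ (E - 1), ⟨k₁ * E, Nat.mul_pos hk₁ hE, ?_⟩, ?_⟩
    · rw [mul_pow, hg'E, one_mul, ← pow_mul, show (E - 1) * (k₁ * E) = E * ((E - 1) * k₁) by ring,
        pow_mul, hgE, one_pow]
    · rw [mul_assoc, ← pow_succ, Nat.sub_add_cancel hE, hgE, mul_one]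
  -- `g = s · g^(n m)` with `s` torsion
  have hs : g = (t₂ * t₁ ^ m) * g ^ (n * m) := by
    conv_lhs => rw [h₂, h₁]
    rw [mul_pow, ← pow_mul, mul_assoc]
  have hsK : (t₂ * t₁ ^ m) ^ (k₁ * k₂) = 1 := by
    rw [mul_pow, show k₁ * k₂ = k₂ * k₁ by ring, pow_mul, ht₂, one_pow, one_mul, ← pow_mul,
      show m * (k₂ * k₁) = k₁ * (m * k₂) by ring, pow_mul, ht₁, one_pow]
  have hK : 0 < k₁ * k₂ := Nat.mul_pos hk₁ hk₂
  have hgK : g ^ (k₁ * k₂) = g ^ (n * m * (k₁ * k₂)) := by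
    conv_lhs => rw [hs]
    rw [mul_pow, hsK, one_mul, ← pow_mul]
  rcases Nat.lt_trichotomy (n * m) 1 with hnm | hnm | hnm
  · -- `n m = 0`: `g` is torsion outright
    have h0 : n * m = 0 := Nat.lt_one_iff.mp hnm
    rw [h0, zero_mul, pow_zero] at hgK
    exact key _ hK hgK
  · -- `n m = 1`: `n = 1`
    have hn : n = 1 := Nat.eq_one_of_mul_eq_one_right hnm
    refine ⟨t₁, ⟨k₁, hk₁, ht₁⟩, ?_⟩
    rw [h₁, hn, pow_one]
  · -- `n m ≥ 2`: cancel `g^K` to see that `g` is torsion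
    obtain ⟨P, hP⟩ : ∃ P : ℕ, n * m = P + 2 := ⟨n * m - 2, by omega⟩
    have hsplit : g ^ (k₁ * k₂) * g ^ ((P + 1) * (k₁ * k₂)) = g ^ (k₁ * k₂) * 1 := by
      rw [mul_one, ← pow_add, show k₁ * k₂ + (P + 1) * (k₁ * k₂) = (P + 2) * (k₁ * k₂) by ring,
        ← hP, ← hgK]
    have htor : g ^ ((P + 1) * (k₁ * k₂)) = 1 := mul_left_cancel hsplit
    exact key _ (Nat.mul_pos P.succ_pos hK) htor

end Generators

/-! ## Definition 3.8 (i): the Θ-pilot object does not depend on the choice of generators, given torsion-invariance of the object-forming algorithm -/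

section Pilots

variable {lstar : ℕ} {V : Type v} {isBad : V → Prop}
variable {Frd : Type u} {IsoF : Frd → Frd → Type w} {Ob : Frd → Type w} {realify : Frd → Frd}
  {Strip : Type u} {IsoS : Strip → Strip → Type w} {M : ∀ v : V, isBad v → Type w}
  [∀ v h, CommMonoid (M v h)] [∀ v h, IsCancelMul (M v h)]

/-- **Well-definedness of the Θ-pilot object** ([IUTchIII] Def. 3.8 (i), p. 112: "the object …
determined by ANY collection, indexed by `v ∈ 𝕍^bad`, of generators up to torsion of the monoids
`Ψ^⊥_{𝓕_lgp}(†𝓗𝓣)_v`"), PROVED from the one property of the object-forming algorithm of Prop. 3.7 (v)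
that the text uses implicitly — it forms "local fractional ideals generated by" its inputs (p. 112
l. 8), hence does not see torsion (unit) factors: under that torsion-invariance (`hinv`), any two
collections of generators up to torsion of the (commutative, cancellative) splitting monoids give the
same object of `†𝒞^⊩_lgp`, i.e. the parent file's named statement `thetaPilotObject_wellDefined` holds.
[cite: Mochizuki2012, III Def 3.8 (i) p.112] -/
theorem thetaPilotObject_wellDefined_of_torsionInvariant
    (S : GlobalLGPFrobenioidSignature lstar V isBad Frd IsoF Ob realify Strip IsoS M)
    (Sp : SplittingMonoids M)
    (hinv : ∀ (g t : ∀ v h, M v h), (∀ v h, ∃ k : ℕ, 0 < k ∧ t v h ^ k = 1) →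
      S.objOfLgp (fun v h => t v h * g v h) = S.objOfLgp g) :
    thetaPilotObject_wellDefined S Sp := by
  intro g g' hg hg'
  have hvh : ∀ v h, ∃ t : M v h, (∃ k : ℕ, 0 < k ∧ t ^ k = 1) ∧
      ((g' v h : M v h) = t * (g v h : M v h)) := by
    intro v h
    obtain ⟨t, ⟨k, hk, htk⟩, e⟩ := (hg v h).exists_torsion_mul_eq (hg' v h)
    refine ⟨(t : M v h), ⟨k, hk, ?_⟩, ?_⟩
    · have := congrArg (fun x : Sp.Msplit v h => (x : M v h)) htk
      simpa only [SubmonoidClass.coe_pow, OneMemClass.coe_one] using this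
    · have := congrArg (fun x : Sp.Msplit v h => (x : M v h)) e
      simpa only [MulMemClass.coe_mul] using this
  choose t ht he using hvh
  have e : (fun v h => (g' v h : M v h)) = fun v h => t v h * (g v h : M v h) :=
    funext fun v => funext fun h => he v h
  rw [e]
  exact (hinv (fun v h => (g v h : M v h)) t ht).symm

end Pilots

end Literature.IUT.LogThetaLattice
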